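import Literature.MathematicalPhysics.QuantumFieldTheory.Balaban1983to89.T4ExpWindowSmallField
import Literature.MathematicalPhysics.QuantumFieldTheory.Balaban1983to89.T4HaarSU2Translate
import Literature.MathematicalPhysics.QuantumFieldTheory.Balaban1983to89.T4WilsonGaugeFlatDirection
import HarnessLib

/-!
# DISTRIBUTED HOLONOMIES IN `SU(2)`: `n`-th ROOTS ALONG A LINE COST `(π²∕4)·dist1(X)²∕n` IN `ℓ²`, AND THE GEODESIC CONTRACTION IS TRANSVERSALLY NON-EXPANDING ON THE HEMISPHERE
# (crux `FluctuationComparisonRegPrIntL`, stmt-QuantumFields-20520; registry v11.4 `Cruxes/FluctuationComparisonRegPrIntL/Lines/semiclassical_s2beta.lean` 3732b7df FROZEN, untouched)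

Cell `ym3-torus` (YM ladder rung R3 = continuum `SU(2)` Yang–Mills on the three-torus — a RUNG: NOT d = 4, NOT infinite volume, NOT a mass gap, NOT Clay).
Width seat `ym3-torus-px12` (gen 22); `--kind proof --supports stmt-QuantumFields-20520 --as helper`, count-neutral, DEFINITION-FREE (0 `def`, 0 `instance`,
0 `notation`, 0 `sorry`, default heartbeats).  Pure group geometry of `SU(2)` through the tree's quaternion exponential chart (lit ✓`T4HaarSU2ExpChart.expPoint`,
✓`T4ExpWindowSmallField.logVec`∕`expPoint_logVec`∕`dist1_eq_two_mul_sin`).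

WHY.  The road to the depth-uniform flat growth letter `hFlat` (third hypothesis of ✓p811100 px16 g19 (D10); px20 g18 UV3-NODE §53 (53.5) «block gauge with DISTRIBUTED transversal
holonomies (N-th roots along lines)»; HOME note `ym3-torus-px12/g22/HFLAT-ROAD-AFTER-6.px12g22.md` (δ), (α)) spreads a face mismatch `X ∈ SU(2)` over the `n` bonds of a line by a
chain `h₀ = X, h₁, …, h_n = 1` of `n`-th roots, paying `Σ_s dist1(h_s h_{s+1}⁻¹)² ≍ dist1(X)²∕n` instead of `dist1(X)²`; transversally (neighbouring lines with nearby data) the chains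
must stay close — true inside the hemisphere `{‖log‖ ≤ π∕2}` and false across the cut locus `−1`.  Both facts are typed here.

WHAT.
* §1 rays of the exponential chart (lit ✓`su2Quat_injective`): `expPoint_add_smul` (`exp((a+b)x) = exp(ax)·exp(bx)` along a ray), `norm_logVec_le_pi_div_two_mul_dist1`
  (`‖log X‖ ≤ (π∕2)·dist1 X`, Jordan's inequality), ★★ `exists_rootChain` (a chain `h : ℕ → SU(2)`, `h 0 = X`, `h s = 1` for `s ≥ n`, every step EQUAL to the root
  `exp(log X ∕ n)` with `dist1 ≤ (π∕2)·dist1(X)∕n`), ★★ `exists_rootChain_sum_sq_le` (`Σ_{s<n} dist1(h_s h_{s+1}⁻¹)² ≤ (π²∕4)·dist1(X)²∕n`).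
* §2 ★★ `dist1_expPoint_smul_mul_inv_le` — THE HEMISPHERE CONTRACTION: for `‖x‖, ‖y‖ ≤ π∕2` and `0 ≤ t ≤ 1`, `dist1(exp(tx)·exp(ty)⁻¹) ≤ dist1(exp(x)·exp(y)⁻¹)` (spherical law of
  cosines: `⟪exp ιu, exp ιv⟫ = cos|u|cos|v| + sin|u|sin|v|·cos∠(u,v)`, and `cos(t(a−b)) ≥ cos(a−b)`, `sin(ta)sin(tb) ≤ sin a sin b` on `[0, π∕2]`).

HONEST: group geometry only; no lattice, no field, no gauge construction; the transversal statement is the hemisphere case only (the cut locus is a genuine obstruction, not treated);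
nothing of Bałaban's analysis; hFlat, TUBE-REG∘, GAP♯∘, EXW∘, S2β, crux 20520 NOT proved; no registered stub is closed; rung R3 = SU(2) YM₃ on T³ — NOT d = 4, NOT infinite volume,
NOT a mass gap, NOT Clay; the Yang–Mills mass gap is NOT proved.  Sorry-free, axioms standard.

References: T. Bałaban, CMP **99** (1985) 75–102 [Balaban1985RegularSpaces] ((1.29) p.81, (1.36) p.82, Thm 2 p.83: the gauge with small, distributed bond variables); CMP **96** (1984)
223–250 [Balaban1984PropagatorsII] ((1.33)); K. Uhlenbeck, CMP **83** (1982) 31–42 [Uhlenbeck1982].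
-/

set_option autoImplicit false

noncomputable section

namespace Summit.QuantumFields.YangMills.Theorems.FluctuationComparisonRegPrIntLS2BetaDistributedHolonomySU2

open NormedSpace
open scoped Real Quaternion RealInnerProductSpace
open Literature.MathematicalPhysics.QuantumLattice (quatMatrix su2Quat quatToSU2 quatMatrix_su2Quat norm_su2Quat quatToSU2_su2Quat)
open Literature.MathematicalPhysics.QuantumFieldTheory.Balaban1983to89
open T4CubeChartGnomonic (SU2)
open T4HaarSU2ExpChart (imQuat imQuat_apply imQuat_re norm_imQuat exp_imQuat exp_imQuat_smul norm_exp_imQuat exp_imQuat_re expPoint expPoint_zero su2Quat_expPoint)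
open T4HaarSU2Translate (su2Quat_mul su2Quat_one)
open T4WilsonGaugeFlatDirection (su2Quat_injective)
open T4ExpWindowSmallField (logVec norm_logVec norm_logVec_le_pi expPoint_logVec dist1_expPoint_le dist1_eq_two_mul_sin dist1_eq_norm_su2Quat_sub_one
  norm_sub_one_sq)

/-! ## §1 Rays of the exponential chart and `n`-th root chains -/

/-- **Along a ray the exponential chart is a one-parameter group**: `exp(ι((a+b)x)) = exp(ι(ax))·exp(ι(bx))`. [folklore] -/
theorem expPoint_add_smul (x : EuclideanSpace ℝ (Fin 3)) (a b : ℝ) :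
    expPoint ((a + b) • x) = expPoint (a • x) * expPoint (b • x) := by
  letI : NormedAlgebra ℚ ℍ := NormedAlgebra.restrictScalars ℚ ℝ ℍ
  apply su2Quat_injective
  rw [su2Quat_mul, su2Quat_expPoint, su2Quat_expPoint, su2Quat_expPoint, add_smul, map_add, map_smul, map_smul]
  exact exp_add_of_commute (((Commute.refl (imQuat x)).smul_left a).smul_right b)

/-- **Jordan's inequality on `SU(2)`**: `‖log X‖ ≤ (π∕2)·dist1 X` (`dist1 X = 2 sin(‖log X‖∕2)`, `‖log X‖ ≤ π`, `sin θ ≥ (2∕π)θ` on `[0, π∕2]`). [folklore] -/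
theorem norm_logVec_le_pi_div_two_mul_dist1 (X : SU2) : ‖logVec (su2Quat X)‖ ≤ π / 2 * dist1 X := by
  rw [dist1_eq_two_mul_sin]
  have h0 : 0 ≤ ‖logVec (su2Quat X)‖ / 2 := by positivity
  have h1 : ‖logVec (su2Quat X)‖ / 2 ≤ π / 2 := by linarith [norm_logVec_le_pi (su2Quat X)]
  have h2 := Real.mul_le_sin h0 h1
  have hπ := Real.pi_pos
  rw [div_mul_eq_mul_div, div_le_iff₀ hπ] at h2
  nlinarith

/-- ★★ **`n`-th ROOT CHAINS**: for `X ∈ SU(2)` and `n ≥ 1` there is `h : ℕ → SU(2)` with `h 0 = X`, `h s = 1` for `s ≥ n`, and EVERY step `h s·(h (s+1))⁻¹` (`s < n`) equal to one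
element `R` (the `n`-th root `exp(ι log X ∕ n)`) with `dist1 R ≤ (π∕2)·dist1 X ∕ n`. [cite: Balaban1985RegularSpaces, (1.29) p.81] -/
theorem exists_rootChain (X : SU2) {n : ℕ} (hn : 0 < n) :
    ∃ h : ℕ → SU2, h 0 = X ∧ (∀ s, n ≤ s → h s = 1) ∧
      ∃ R : SU2, dist1 R ≤ π / 2 * dist1 X / n ∧ ∀ s, s < n → h s * (h (s + 1))⁻¹ = R := by
  have hn' : (n : ℝ) ≠ 0 := by exact_mod_cast hn.ne'
  refine ⟨fun s => expPoint ((((n - s : ℕ) : ℝ) / n) • logVec (su2Quat X)), ?_, ?_, expPoint (((1 : ℝ) / n) • logVec (su2Quat X)), ?_, ?_⟩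
  · show expPoint ((((n - 0 : ℕ) : ℝ) / n) • logVec (su2Quat X)) = X
    rw [Nat.sub_zero, div_self hn', one_smul, expPoint_logVec]
  · intro s hs
    show expPoint ((((n - s : ℕ) : ℝ) / n) • logVec (su2Quat X)) = 1
    rw [Nat.sub_eq_zero_of_le hs, Nat.cast_zero, zero_div, zero_smul, expPoint_zero]
  · refine (dist1_expPoint_le _).trans ?_
    rw [norm_smul, norm_div, norm_one, Real.norm_eq_abs, abs_of_pos (by exact_mod_cast hn : (0 : ℝ) < n)]
    have h := norm_logVec_le_pi_div_two_mul_dist1 X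
    rw [one_div, inv_mul_eq_div, div_le_div_iff_of_pos_right (by exact_mod_cast hn : (0 : ℝ) < n)]
    exact h
  · intro s hs
    show expPoint ((((n - s : ℕ) : ℝ) / n) • logVec (su2Quat X)) * (expPoint ((((n - (s + 1) : ℕ) : ℝ) / n) • logVec (su2Quat X)))⁻¹ =
      expPoint (((1 : ℝ) / n) • logVec (su2Quat X))
    have e : (((n - s : ℕ) : ℝ) / n) = 1 / n + (((n - (s + 1) : ℕ) : ℝ) / n) := by
      rw [Nat.cast_sub hs.le, Nat.cast_sub (Nat.succ_le_of_lt hs), Nat.cast_succ]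
      field_simp
      ring
    rw [e, expPoint_add_smul, mul_inv_cancel_right]

/-- ★★ **THE `ℓ²` COST OF A DISTRIBUTED HOLONOMY**: the root chain pays `Σ_{s<n} dist1(h_s·h_{s+1}⁻¹)² ≤ (π²∕4)·dist1(X)²∕n` (instead of `dist1(X)²` for the undistributed jump).
[cite: Balaban1985RegularSpaces, (1.29) p.81, (1.36) p.82] -/
theorem exists_rootChain_sum_sq_le (X : SU2) {n : ℕ} (hn : 0 < n) :
    ∃ h : ℕ → SU2, h 0 = X ∧ (∀ s, n ≤ s → h s = 1) ∧ (∀ s, s < n → dist1 (h s * (h (s + 1))⁻¹) ≤ π / 2 * dist1 X / n) ∧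
      ∑ s ∈ Finset.range n, dist1 (h s * (h (s + 1))⁻¹) ^ 2 ≤ π ^ 2 / 4 * dist1 X ^ 2 / n := by
  obtain ⟨h, h0, h1, R, hR, hstep⟩ := exists_rootChain X hn
  have hn0 : (0 : ℝ) < n := by exact_mod_cast hn
  refine ⟨h, h0, h1, fun s hs => by rw [hstep s hs]; exact hR, ?_⟩
  have hR0 : 0 ≤ dist1 R := GaugeGroup.dist1_nonneg _
  calc ∑ s ∈ Finset.range n, dist1 (h s * (h (s + 1))⁻¹) ^ 2 = ∑ s ∈ Finset.range n, dist1 R ^ 2 :=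
        Finset.sum_congr rfl fun s hs => by rw [hstep s (Finset.mem_range.1 hs)]
    _ = (n : ℝ) * dist1 R ^ 2 := by rw [Finset.sum_const, Finset.card_range, nsmul_eq_mul]
    _ ≤ (n : ℝ) * (π / 2 * dist1 X / n) ^ 2 := mul_le_mul_of_nonneg_left (pow_le_pow_left₀ hR0 hR 2) hn0.le
    _ = π ^ 2 / 4 * dist1 X ^ 2 / n := by field_simp; ring

/-! ## §2 The hemisphere contraction: geodesic scaling toward `1` does not expand transversal distances when `‖log‖ ≤ π∕2` -/

/-- `sinc x · x = sin x` (all real `x`). [folklore] -/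
private theorem sinc_mul_self (x : ℝ) : Real.sinc x * x = Real.sin x := by
  by_cases hx : x = 0
  · simp [hx]
  · rw [Real.sinc_of_ne_zero hx, div_mul_cancel₀ _ hx]

/-- **The spherical law of cosines in the quaternion model**: `⟪exp ιu, exp ιv⟫ = cos|u| cos|v| + sinc|u| sinc|v| ⟪u, v⟫`. [folklore] -/
theorem inner_exp_imQuat (u v : EuclideanSpace ℝ (Fin 3)) :
    inner ℝ (exp (imQuat u)) (exp (imQuat v)) = Real.cos ‖u‖ * Real.cos ‖v‖ + Real.sinc ‖u‖ * Real.sinc ‖v‖ * inner ℝ u v := by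
  letI : NormedAlgebra ℚ ℍ := NormedAlgebra.restrictScalars ℚ ℝ ℍ
  have h1 : inner ℝ (Real.cos ‖u‖ : ℍ) (Real.cos ‖v‖ : ℍ) = Real.cos ‖u‖ * Real.cos ‖v‖ := by simp [Quaternion.inner_def]
  have h2 : inner ℝ (Real.cos ‖u‖ : ℍ) (imQuat v) = 0 := by simp [Quaternion.inner_def, imQuat_apply]
  have h3 : inner ℝ (imQuat u) (Real.cos ‖v‖ : ℍ) = 0 := by simp [Quaternion.inner_def, imQuat_apply]
  have h4 : inner ℝ (imQuat u) (imQuat v) = inner ℝ u v := by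
    simp [Quaternion.inner_def, imQuat_apply, PiLp.inner_apply, Fin.sum_univ_three]
    ring
  rw [exp_imQuat, exp_imQuat, inner_add_left, inner_add_right, inner_add_right, real_inner_smul_right, real_inner_smul_left,
    real_inner_smul_left, real_inner_smul_right, h1, h2, h3, h4]
  ring

/-- **The chord between two points of the unit sphere**: `|exp ιu − exp ιv|² = 2 − 2⟪exp ιu, exp ιv⟫`. [folklore] -/
theorem norm_exp_imQuat_sub_sq (u v : EuclideanSpace ℝ (Fin 3)) :
    ‖exp (imQuat u) - exp (imQuat v)‖ ^ 2 = 2 - 2 * inner ℝ (exp (imQuat u)) (exp (imQuat v)) := by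
  letI : NormedAlgebra ℚ ℍ := NormedAlgebra.restrictScalars ℚ ℝ ℍ
  rw [@norm_sub_sq_real ℍ, norm_exp_imQuat, norm_exp_imQuat]
  ring

/-- **The trigonometric heart**: for `0 ≤ a, b ≤ π∕2`, `0 ≤ t ≤ 1` and `|D| ≤ ab` (the range of `⟪u, v⟫`),
`cos(ta)cos(tb) + sinc(ta)sinc(tb)·t²D ≥ cos a cos b + sinc a sinc b·D` — linear in `D`, and at `D = ±ab` it is `cos(t(a ∓ b)) ≥ cos(a ∓ b)` (`a + b ≤ π`: the hemisphere). [folklore] -/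
theorem cos_mul_cos_add_sinc_mono {a b t D : ℝ} (ha0 : 0 ≤ a) (ha : a ≤ π / 2) (hb0 : 0 ≤ b) (hb : b ≤ π / 2) (ht0 : 0 ≤ t) (ht1 : t ≤ 1)
    (hD : |D| ≤ a * b) :
    Real.cos a * Real.cos b + Real.sinc a * Real.sinc b * D ≤
      Real.cos (t * a) * Real.cos (t * b) + Real.sinc (t * a) * Real.sinc (t * b) * (t * t * D) := by
  have hπ := Real.pi_pos
  -- the two endpoint inequalities `cos(t(a∓b)) ≥ cos(a∓b)`
  have hplus : Real.cos (a + b) ≤ Real.cos (t * (a + b)) :=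
    Real.cos_le_cos_of_nonneg_of_le_pi (by positivity) (by linarith) (by nlinarith)
  have hminus : Real.cos (a - b) ≤ Real.cos (t * (a - b)) := by
    rw [← Real.cos_abs (a - b), ← Real.cos_abs (t * (a - b)), abs_mul, abs_of_nonneg ht0]
    have hab : |a - b| ≤ π := by rw [abs_le]; constructor <;> linarith
    exact Real.cos_le_cos_of_nonneg_of_le_pi (by positivity) hab (by nlinarith [abs_nonneg (a - b)])
  -- sines through `sinc`
  have hsa : Real.sinc a * a = Real.sin a := sinc_mul_self a
  have hsb : Real.sinc b * b = Real.sin b := sinc_mul_self b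
  have hsta : Real.sinc (t * a) * (t * a) = Real.sin (t * a) := sinc_mul_self (t * a)
  have hstb : Real.sinc (t * b) * (t * b) = Real.sin (t * b) := sinc_mul_self (t * b)
  rw [show t * (a + b) = t * a + t * b by ring, Real.cos_add, Real.cos_add] at hplus
  rw [show t * (a - b) = t * a - t * b by ring, Real.cos_sub, Real.cos_sub] at hminus
  -- linear in `D`: `α·D + β ≥ 0` on `|D| ≤ ab` from the endpoint values `β ± α·ab ≥ 0`
  have hendP : 0 ≤ (Real.cos (t * a) * Real.cos (t * b) - Real.cos a * Real.cos b) +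
      (Real.sinc (t * a) * Real.sinc (t * b) * (t * t) - Real.sinc a * Real.sinc b) * (a * b) := by
    have e1 : Real.sinc (t * a) * Real.sinc (t * b) * (t * t) * (a * b) = Real.sin (t * a) * Real.sin (t * b) := by
      rw [← hsta, ← hstb]; ring
    have e2 : Real.sinc a * Real.sinc b * (a * b) = Real.sin a * Real.sin b := by rw [← hsa, ← hsb]; ring
    nlinarith [e1, e2]
  have hendM : 0 ≤ (Real.cos (t * a) * Real.cos (t * b) - Real.cos a * Real.cos b) -
      (Real.sinc (t * a) * Real.sinc (t * b) * (t * t) - Real.sinc a * Real.sinc b) * (a * b) := by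
    have e1 : Real.sinc (t * a) * Real.sinc (t * b) * (t * t) * (a * b) = Real.sin (t * a) * Real.sin (t * b) := by
      rw [← hsta, ← hstb]; ring
    have e2 : Real.sinc a * Real.sinc b * (a * b) = Real.sin a * Real.sin b := by rw [← hsa, ← hsb]; ring
    nlinarith [e1, e2]
  have hD1 := (abs_le.1 hD).1
  have hD2 := (abs_le.1 hD).2
  rcases eq_or_lt_of_le (mul_nonneg ha0 hb0) with hab | hab
  · -- `ab = 0`: then `D = 0`
    have hD0 : D = 0 := by rw [← hab] at hD; exact abs_nonpos_iff.1 hD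
    rw [← hab] at hendP
    rw [hD0]
    nlinarith
  · nlinarith [mul_nonneg (hendP) (show 0 ≤ a * b + D by linarith), mul_nonneg hendM (show 0 ≤ a * b - D by linarith)]

/-- ★★ **THE HEMISPHERE CONTRACTION**: for `‖x‖, ‖y‖ ≤ π∕2` and `0 ≤ t ≤ 1`, `dist1(exp(ι tx)·exp(ι ty)⁻¹) ≤ dist1(exp(ι x)·exp(ι y)⁻¹)` — scaling two points of the closed hemisphere
geodesically toward `1` by the same factor does not increase their distance (so distributing NEARBY face data over parallel lines keeps the lines' transversal differences bounded by the data's;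
false across the cut locus `−1`, which is why the hemisphere hypothesis is there). [cite: Balaban1985RegularSpaces, (1.36) p.82] -/
theorem dist1_expPoint_smul_mul_inv_le (x y : EuclideanSpace ℝ (Fin 3)) (hx : ‖x‖ ≤ π / 2) (hy : ‖y‖ ≤ π / 2) {t : ℝ} (ht0 : 0 ≤ t) (ht1 : t ≤ 1) :
    dist1 (expPoint (t • x) * (expPoint (t • y))⁻¹) ≤ dist1 (expPoint x * (expPoint y)⁻¹) := by
  letI : NormedAlgebra ℚ ℍ := NormedAlgebra.restrictScalars ℚ ℝ ℍ
  -- `dist1 (U V⁻¹) = |su2Quat U − su2Quat V|`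
  have hkey : ∀ U V : SU2, dist1 (U * V⁻¹) = ‖su2Quat U - su2Quat V‖ := by
    intro U V
    have hVinv : su2Quat V⁻¹ = (su2Quat V)⁻¹ := by
      have h1 : su2Quat V * su2Quat V⁻¹ = 1 := by rw [← su2Quat_mul, mul_inv_cancel, su2Quat_one]
      have hV0 : su2Quat V ≠ 0 := fun h0 => by rw [h0, zero_mul] at h1; exact zero_ne_one h1
      exact (eq_inv_of_mul_eq_one_right h1).symm ▸ rfl
    rw [dist1_eq_norm_su2Quat_sub_one, su2Quat_mul, hVinv]
    have hV1 : ‖su2Quat V‖ = 1 := norm_su2Quat V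
    have hV0 : su2Quat V ≠ 0 := norm_ne_zero_iff.1 (by rw [hV1]; exact one_ne_zero)
    rw [show su2Quat U * (su2Quat V)⁻¹ - 1 = (su2Quat U - su2Quat V) * (su2Quat V)⁻¹ by rw [sub_mul, mul_inv_cancel₀ hV0],
      norm_mul, norm_inv, hV1, inv_one, mul_one]
  rw [hkey, hkey, su2Quat_expPoint, su2Quat_expPoint, su2Quat_expPoint, su2Quat_expPoint]
  -- squares: `2 − 2⟪·,·⟫`
  have hsq : ‖exp (imQuat (t • x)) - exp (imQuat (t • y))‖ ^ 2 ≤ ‖exp (imQuat x) - exp (imQuat y)‖ ^ 2 := by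
    rw [norm_exp_imQuat_sub_sq, norm_exp_imQuat_sub_sq, inner_exp_imQuat, inner_exp_imQuat, norm_smul, norm_smul, Real.norm_eq_abs,
      abs_of_nonneg ht0, real_inner_smul_left, real_inner_smul_right, ← mul_assoc]
    have hD : |inner ℝ x y| ≤ ‖x‖ * ‖y‖ := abs_real_inner_le_norm x y
    have h := cos_mul_cos_add_sinc_mono (norm_nonneg x) hx (norm_nonneg y) hy ht0 ht1 hD
    linarith
  exact (pow_le_pow_iff_left₀ (norm_nonneg _) (norm_nonneg _) two_ne_zero).1 hsq

end Summit.QuantumFields.YangMills.Theorems.FluctuationComparisonRegPrIntLS2BetaDistributedHolonomySU2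

end
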